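import Summits.CriticalPhenomena.SAWScalingLimit.Theorems.ShellCrossingBound.Negative.OfEventualTight

/-!
# `ShellCrossingBound` — negative knowledge: even the centre-dependence of the threshold is decorative

Support file for crux `stmt-CriticalPhenomena-4728` (refuter `cdisprove`). Sequel to
`Negative/OfEventualTight.lean`: under the target `EventualTight` the traversal threshold can be
chosen as a function of the RADII only, `k ρ R`, uniformly in the centre `x ∈ ℂ`
(`radiiThreshold_of_eventualTight`), for ANY positive target. Together with
`Negative/UniformThresholdFalse.lean` (a threshold uniform in the radii is refuted by boundary
forcing) this pins down exactly where the content of an Aizenman–Burchard-type crux for the SAW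
can sit: uniformity in the radii, on interior shells only. Everything proved. [folklore]
-/

noncomputable section

open Set Filter Topology Metric MeasureTheory
open scoped ENNReal
open Literature.Probability.RandomPlanarGeometry Literature.Probability.LatticeModels

namespace Summit.CriticalPhenomena.SAWScalingLimit.Theorems.ShellCrossingBound.Negative

open Summit.CriticalPhenomena.SAWScalingLimit.Theses.SAWRenewalTightness

/-- **On a compact set of curve classes the number of separate traversals of the shells
`D(x; r, R)`, `r < R` fixed, is bounded UNIFORMLY IN THE CENTRE `x`.** The centres of traversed
shells stay in a fixed compact ball (every curve of the set is within a bounded reparametrisation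
distance of a fixed one); extract convergent subsequences of centres and classes and transfer the
traversals to the limit centre (`HasTraversals.mono`) and the limit curve
(`hasTraversals_of_dist_lt`), contradicting `Curve.exists_not_hasTraversals`. [folklore] -/
theorem exists_forall_center_not_hasTraversals_of_isCompact {𝒦 : Set (CurveClass ℂ)}
    (h𝒦 : IsCompact 𝒦) {r R : ℝ} (hrR : r < R) :
    ∃ k, ∀ (x : ℂ) (γ : Curve ℂ), CurveClass.mk γ ∈ 𝒦 → ¬ γ.HasTraversals k x r R := by
  by_contra hcon
  push Not at hcon
  -- shift the index so that every witness has at least one traversal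
  choose x γ hγmem hγtrav using fun k => hcon (k + 1)
  rcases 𝒦.eq_empty_or_nonempty with h0 | ⟨c₀, hc₀⟩
  · exact (h0 ▸ hγmem 0 : CurveClass.mk (γ 0) ∈ (∅ : Set (CurveClass ℂ)))
  obtain ⟨γ₀, rfl⟩ := CurveClass.surjective_mk c₀
  -- all classes of `𝒦` are within `D₀` of `[γ₀]`, the range of `γ₀` within `D₁` of `γ₀ 0`
  obtain ⟨D₀, hD₀⟩ := h𝒦.isBounded.subset_closedBall (CurveClass.mk γ₀)
  obtain ⟨D₁, hD₁⟩ := γ₀.isCompact_range.isBounded.subset_closedBall (γ₀ 0)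
  -- hence all centres lie in a fixed compact ball
  set S : Set ℂ := closedBall (γ₀ 0) (|D₀| + 1 + |D₁| + |r|) with hS
  have hxS : ∀ k, x k ∈ S := by
    intro k
    obtain ⟨s, t, hst, -⟩ := hγtrav k
    -- a time at which `γ k` is within `r` of `x k`
    obtain ⟨u, hu⟩ : ∃ u, dist (γ k u) (x k) ≤ r := by
      rcases (hst 0).2 with ⟨h1, -⟩ | ⟨-, h2⟩
      · exact ⟨s 0, h1⟩
      · exact ⟨t 0, h2⟩
    have hdist : dist (γ k) γ₀ ≤ |D₀| := by
      have := hD₀ (hγmem k)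
      rw [mem_closedBall, CurveClass.mk_eq_separationQuotientMk, SeparationQuotient.dist_mk] at this
      exact this.trans (le_abs_self _)
    have hinf : infDist (γ k u) γ₀.range < |D₀| + 1 :=
      ((Curve.infDist_range_le (γ k) γ₀ u).trans hdist).trans_lt (by linarith)
    obtain ⟨q, hq, hdq⟩ := (infDist_lt_iff γ₀.range_nonempty).1 hinf
    have hq0 : dist q (γ₀ 0) ≤ |D₁| := (hD₁ hq).trans (le_abs_self _)
    rw [hS, mem_closedBall]
    calc dist (x k) (γ₀ 0) ≤ dist (x k) (γ k u) + dist (γ k u) q + dist q (γ₀ 0) := dist_triangle4 _ _ _ _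
      _ ≤ |r| + (|D₀| + 1) + |D₁| := by
          gcongr
          · rw [dist_comm]; exact hu.trans (le_abs_self _)
      _ = |D₀| + 1 + |D₁| + |r| := by ring
  -- subsequence along which the centres converge …
  obtain ⟨x₀, -, ψ, hψ, hxlim⟩ := (isCompact_closedBall _ _).isSeqCompact hxS
  -- … and a further one along which the classes converge
  obtain ⟨c, -, φ, hφ, hclim⟩ := h𝒦.isSeqCompact (x := fun n => CurveClass.mk (γ (ψ n))) fun n => hγmem _
  obtain ⟨γ₁, rfl⟩ := CurveClass.surjective_mk c
  set η : ℝ := (R - r) / 5 with hη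
  have hη0 : 0 < η := by rw [hη]; linarith
  obtain ⟨k₀, hk₀⟩ := Curve.exists_not_hasTraversals γ₁ x₀ (r := r + η + η) (R := R - η - η) (by rw [hη]; linarith)
  rw [Metric.tendsto_atTop] at hxlim hclim
  obtain ⟨N₁, hN₁⟩ := hxlim η hη0
  obtain ⟨N₂, hN₂⟩ := hclim η hη0
  -- a common large index
  set n : ℕ := max (max N₁ N₂) k₀ with hn
  have hn₂ : N₂ ≤ n := (le_max_right _ _).trans (le_max_left _ _)
  have hn₁ : N₁ ≤ φ n := ((le_max_left _ _).trans (le_max_left _ _)).trans (hφ.id_le _)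
  have hnk : k₀ ≤ ψ (φ n) + 1 := (le_max_right _ _).trans ((hψ.id_le _).trans ((hφ.id_le _ |> hψ.monotone).trans (Nat.le_succ _)))
  have hx : dist (x (ψ (φ n))) x₀ < η := hN₁ (φ n) hn₁
  have hc : dist (CurveClass.mk (γ (ψ (φ n)))) (CurveClass.mk γ₁) < η := hN₂ n hn₂
  simp only [CurveClass.mk_eq_separationQuotientMk, SeparationQuotient.dist_mk] at hc
  -- transfer: centre, then curve
  have h1 : (γ (ψ (φ n))).HasTraversals k₀ (x (ψ (φ n))) r R := (hγtrav _).of_le hnk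
  have h2 : (γ (ψ (φ n))).HasTraversals k₀ x₀ (r + η) (R - η) :=
    h1.mono (by linarith [hx.le, dist_comm (x (ψ (φ n))) x₀]) (by linarith [hx.le, dist_comm (x (ψ (φ n))) x₀])
  rw [dist_comm] at hc
  exact hk₀ (hasTraversals_of_dist_lt hc h2)

/-- **Tightness ⇒ thresholds depending on the radii only.** If the pushed-forward SAW laws over
`δ ∈ T` form a tight set, then for every target `f ρ R`, positive on `0 < ρ < R`, there is a
threshold `k ρ R` — INDEPENDENT OF THE CENTRE — with
`P_δ[k ρ R separate traversals of D(x; ρ, R)] ≤ f ρ R` for all `δ ∈ T`, all `x ∈ ℂ` and all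
`0 < ρ < R`. [folklore] -/
theorem radiiTargets_of_isTightMeasureSet (Ω : Set ℂ) (a b : ℝ → Site 2) (T : Set ℝ)
    (htight : IsTightMeasureSet
      ((fun δ => (SAW.law Ω δ (a δ) (b δ)).map (fun γ => γ.curve)) '' T))
    (f : ℝ → ℝ → ℝ≥0∞) (hf : ∀ ρ R, 0 < ρ → ρ < R → f ρ R ≠ 0) :
    ∃ k : ℝ → ℝ → ℕ, ∀ δ ∈ T, ∀ (x : ℂ) (ρ R : ℝ), 0 < ρ → ρ < R →
      SAW.law Ω δ (a δ) (b δ)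
        {γ | (⟨γ.walk.toCurve (meshPoint δ)⟩ : Curve ℂ).HasTraversals (k ρ R) x ρ R} ≤ f ρ R := by
  rw [isTightMeasureSet_iff_exists_isCompact_measure_compl_le] at htight
  have key : ∀ (ρ R : ℝ), ∃ k : ℕ, 0 < ρ → ρ < R → ∀ δ ∈ T, ∀ x : ℂ,
      SAW.law Ω δ (a δ) (b δ)
        {γ | (⟨γ.walk.toCurve (meshPoint δ)⟩ : Curve ℂ).HasTraversals k x ρ R} ≤ f ρ R := by
    intro ρ R
    by_cases hρR : 0 < ρ ∧ ρ < R
    · obtain ⟨𝒦, h𝒦, hμ⟩ := htight (f ρ R) (pos_iff_ne_zero.2 (hf ρ R hρR.1 hρR.2))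
      obtain ⟨k, hk⟩ := exists_forall_center_not_hasTraversals_of_isCompact h𝒦 hρR.2
      refine ⟨k, fun _ _ δ hδ x => ?_⟩
      calc SAW.law Ω δ (a δ) (b δ)
            {γ | (⟨γ.walk.toCurve (meshPoint δ)⟩ : Curve ℂ).HasTraversals k x ρ R}
          ≤ SAW.law Ω δ (a δ) (b δ) ((fun γ => γ.curve) ⁻¹' 𝒦ᶜ) := by
            refine measure_mono fun γ hγ => ?_
            exact fun hmem => hk x _ hmem hγ
        _ ≤ ((SAW.law Ω δ (a δ) (b δ)).map (fun γ => γ.curve)) 𝒦ᶜ :=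
            Measure.le_map_apply (SAW.aemeasurable_curve _ _ _ _) _
        _ ≤ f ρ R := hμ _ ⟨δ, hδ, rfl⟩
    · exact ⟨0, fun h1 h2 => absurd ⟨h1, h2⟩ hρR⟩
  choose k hk using key
  exact ⟨k, fun δ hδ x ρ R hρ hρR => hk ρ R hρ hρR δ hδ x⟩

/-- **Under the target, the crux holds with a threshold depending on the radii only** (and
`K = 1`, `λ = 3`, no `δ ≤ ρ`, no `R ≤ 1`): the centre-dependence `k x ρ R` of the crux is as
decorative as its constants. [folklore] -/
theorem radiiThreshold_of_eventualTight (hT : EventualTight) (D : DobrushinDomain) (a b : ℝ → Site 2)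
    (hab : SAW.IsEndpointApprox D a b) :
    ∃ (k : ℝ → ℝ → ℕ) (δ₀ : ℝ), 0 < δ₀ ∧ ∀ δ ∈ Set.Ioc (0 : ℝ) δ₀, ∀ (x : ℂ) (ρ R : ℝ), 0 < ρ → ρ < R →
      SAW.law D.carrier δ (a δ) (b δ)
        {γ | (⟨γ.walk.toCurve (meshPoint δ)⟩ : Curve ℂ).HasTraversals (k ρ R) x ρ R}
          ≤ ENNReal.ofReal (1 * (ρ / R) ^ (3 : ℝ)) := by
  obtain ⟨δ₀, hδ₀, htight⟩ := hT D a b hab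
  obtain ⟨k, hk⟩ := radiiTargets_of_isTightMeasureSet D.carrier a b _ htight
    (fun ρ R => ENNReal.ofReal (1 * (ρ / R) ^ (3 : ℝ))) (by
      intro ρ R hρ hρR
      have hR : 0 < R := hρ.trans hρR
      have : 0 < 1 * (ρ / R) ^ (3 : ℝ) := by
        rw [one_mul]
        exact Real.rpow_pos_of_pos (div_pos hρ hR) _
      exact (ENNReal.ofReal_pos.2 this).ne')
  exact ⟨k, δ₀, hδ₀, hk⟩

end Summit.CriticalPhenomena.SAWScalingLimit.Theorems.ShellCrossingBound.Negative
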